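import Summits.AtomisticToContinuum.HydrodynamicLimit.Theorems.JParityClosureRateFloorLineDefs
import Literature.MathematicalPhysics.KineticTheory.CollisionTubeFirstContact
import Literature.Analysis.FluidPDE.HardSphereShortTime
import HarnessLib

/-!
# Line `Sketch` of crux `RateFloor`: the would-be pairs of the line contain the collision tube
# (helper file, `--supports stmt-AtomisticToContinuum-13080`)

Bridge between the static functionals of the line `Sketch` (`Theorems/JParityClosureRateFloorLineDefs.lean`:
`wouldBePairs`, `firstContact`, the predicted datum of `wouldBeSum`) and the tree's static collision tube
(`Literature/…/CollisionTubeGeometry.lean`, `CollisionTubeFirstContact.lean`: `strictTube`, `flightTime`,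
`impactNormal`), for the window `Δ = κ ε` of the fixed-time collision-tube functional `tubeStat`
(`CollisionTubeFunctional.lean`; `b = 1/3`, `A = κσ` in the line's `windowLenB`).  For an ordered pair `(i, j)`,
`i ≠ j`, of a configuration `z` on `𝕋³ × ℝ³` with minimal-image separation `q = sepVec xᵢ xⱼ` and relative
velocity `w = vᵢ − vⱼ`, inside the chart `‖q‖ + κ ε ‖w‖ < 1/2` (so that the minimal image is additive along the
free flight, `Alexander.sepVec_freeFlight_eq`):

* `norm_sepVec_freeFlight_eq` — the distance of the free flights at time `u ∈ [0, κε]` is `‖q + u w‖`;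
* `mem_wouldBePairs_of_smul_mem_strictTube` — if `ε⁻¹ q` lies in the strict unit tube of `w` then `(i, j)` is a
  WOULD-BE pair of the window `(0, κ ε]`;
* `firstContact_eq_mul_flightTime` — and its first contact time is `ε t_h(ε⁻¹ q)` (the infimum of the line's
  definition is attained at the smaller root: `CollisionTubeFirstContact.sInf_eq_mul_flightTime`);
* `sepVec_freeFlight_firstContact` — the predicted separation there is `ε n_h(ε⁻¹ q)` (so the line's predicted
  impact datum `(ε⁻¹ sepVec, vᵢ, vⱼ)` is the tube's `(impactNormal, vᵢ, vⱼ)`), of norm `ε`;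
* `chart_of_smul_mem_strictTube` — the chart condition holds on the tube as soon as `ε (1 + 2κ‖w‖) < 1/2`.

Consequence for the rung-0 floor (`stub_staticOpacityFloorRung0`): for a nonnegative mark the would-be marked sum of
the line dominates the strict-tube marked sum with the SAME predicted datum, to which the one-sided tube mean
`Literature/…/CollisionTubePairMeanLowerBound.pair_tubeMark_mean_ge` applies.  Elementary; GST 2013 §4.1.
-/

noncomputable section

open scoped BigOperators Classical InnerProductSpace
open MeasureTheory Set
open Literature.Analysis.FluidPDE Literature.MathematicalPhysics.KineticTheory

namespace Summit.AtomisticToContinuum.HydrodynamicLimit.Theorems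

namespace RateFloorTubeBridge

open RateFloorLine

variable {n : ℕ}

/-- **The chart along the window**: if `‖q‖ + κ ε ‖w‖ < 1/2` then for every `u ∈ [0, κ ε]` the separation of
the free flights of `i`, `j` at time `u` is `q + u w`. [folklore] -/
theorem sepVec_freeFlight_eq_of_chart {ε κ : ℝ} {z : Config n (Fin 3) T3} {i j : Fin n}
    (hchart : ‖(Torus.geometry (Fin 3)).sepVec (z i).1 (z j).1‖ + κ * ε * ‖(z i).2 - (z j).2‖ < 1 / 2)
    {u : ℝ} (hu0 : 0 ≤ u) (hu : u ≤ κ * ε) :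
    (Torus.geometry (Fin 3)).sepVec (freeFlight (Torus.geometry (Fin 3)) u z i).1
        (freeFlight (Torus.geometry (Fin 3)) u z j).1 =
      (Torus.geometry (Fin 3)).sepVec (z i).1 (z j).1 + u • ((z i).2 - (z j).2) := by
  refine Alexander.sepVec_freeFlight_eq ?_
  rw [abs_of_nonneg hu0]
  have : u * ‖(z i).2 - (z j).2‖ ≤ κ * ε * ‖(z i).2 - (z j).2‖ := mul_le_mul_of_nonneg_right hu (norm_nonneg _)
  linarith

/-- The distance of the free flights at time `u ∈ [0, κε]` is `‖q + u w‖`. [folklore] -/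
theorem norm_sepVec_freeFlight_eq {ε κ : ℝ} {z : Config n (Fin 3) T3} {i j : Fin n}
    (hchart : ‖(Torus.geometry (Fin 3)).sepVec (z i).1 (z j).1‖ + κ * ε * ‖(z i).2 - (z j).2‖ < 1 / 2)
    {u : ℝ} (hu0 : 0 ≤ u) (hu : u ≤ κ * ε) :
    ‖(Torus.geometry (Fin 3)).sepVec (freeFlight (Torus.geometry (Fin 3)) u z i).1
        (freeFlight (Torus.geometry (Fin 3)) u z j).1‖ =
      ‖(Torus.geometry (Fin 3)).sepVec (z i).1 (z j).1 + u • ((z i).2 - (z j).2)‖ := by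
  rw [sepVec_freeFlight_eq_of_chart hchart hu0 hu]

/-- **The chart condition holds on the tube**: if `ε⁻¹ q` is in the strict unit tube of `w` and
`ε (1 + 2κ‖w‖) < 1/2` then `‖q‖ + κ ε ‖w‖ < 1/2` (`‖q‖ ≤ ε(1 + κ‖w‖)` on the tube). [folklore] -/
theorem chart_of_smul_mem_strictTube {ε κ : ℝ} (hε : 0 < ε) {q w : V3}
    (hq : ε⁻¹ • q ∈ strictTube κ w) (hsmall : ε * (1 + 2 * κ * ‖w‖) < 1 / 2) :
    ‖q‖ + κ * ε * ‖w‖ < 1 / 2 := by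
  have h := (norm_le_of_smul_mem_strictTube hε hq).2
  nlinarith [h, norm_nonneg w, hε]

/-- **A strict-tube pair is a would-be pair of the line**: if `ε⁻¹ sepVec xᵢ xⱼ ∈ strictTube κ (vᵢ − vⱼ)`,
`i ≠ j`, inside the chart, then `(i, j) ∈ wouldBePairs ε (κ ε) z` (at `u = ε t_h` the free flights are at distance
exactly `ε`). [folklore] -/
theorem mem_wouldBePairs_of_smul_mem_strictTube {ε κ : ℝ} (hε : 0 < ε) {z : Config n (Fin 3) T3}
    {i j : Fin n} (hij : i ≠ j)
    (hchart : ‖(Torus.geometry (Fin 3)).sepVec (z i).1 (z j).1‖ + κ * ε * ‖(z i).2 - (z j).2‖ < 1 / 2)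
    (hq : ε⁻¹ • (Torus.geometry (Fin 3)).sepVec (z i).1 (z j).1 ∈ strictTube κ ((z i).2 - (z j).2)) :
    (i, j) ∈ wouldBePairs ε (κ * ε) z := by
  have hL := isLeast_mul_flightTime hε hq
  obtain ⟨⟨h0, hκε⟩, hle⟩ := hL.1
  simp only [wouldBePairs, Finset.mem_filter, Finset.mem_univ, true_and]
  refine ⟨hij, ε * flightTime ((z i).2 - (z j).2) (ε⁻¹ • (Torus.geometry (Fin 3)).sepVec (z i).1 (z j).1),
    ⟨h0, hκε⟩, ?_⟩
  rw [norm_sepVec_freeFlight_eq hchart h0.le hκε]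
  exact hle

/-- **The first contact time of a strict-tube pair is `ε t_h(ε⁻¹ q)`** (the infimum in the line's
`firstContact` is a minimum, attained at the smaller root of the contact quadratic). [folklore] -/
theorem firstContact_eq_mul_flightTime {ε κ : ℝ} (hε : 0 < ε) {z : Config n (Fin 3) T3} {i j : Fin n}
    (hchart : ‖(Torus.geometry (Fin 3)).sepVec (z i).1 (z j).1‖ + κ * ε * ‖(z i).2 - (z j).2‖ < 1 / 2)
    (hq : ε⁻¹ • (Torus.geometry (Fin 3)).sepVec (z i).1 (z j).1 ∈ strictTube κ ((z i).2 - (z j).2)) :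
    firstContact ε (κ * ε) z (i, j) =
      ε * flightTime ((z i).2 - (z j).2) (ε⁻¹ • (Torus.geometry (Fin 3)).sepVec (z i).1 (z j).1) := by
  rw [firstContact, ← sInf_eq_mul_flightTime hε hq]
  congr 1
  ext u
  simp only [mem_setOf_eq]
  constructor
  · rintro ⟨hu, hle⟩
    exact ⟨hu, by rwa [norm_sepVec_freeFlight_eq hchart hu.1.le hu.2] at hle⟩
  · rintro ⟨hu, hle⟩
    exact ⟨hu, by rwa [norm_sepVec_freeFlight_eq hchart hu.1.le hu.2]⟩

/-- The first contact time of a strict-tube pair lies in the window `(0, κε]`. [folklore] -/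
theorem firstContact_mem_Ioc {ε κ : ℝ} (hε : 0 < ε) {z : Config n (Fin 3) T3} {i j : Fin n}
    (hchart : ‖(Torus.geometry (Fin 3)).sepVec (z i).1 (z j).1‖ + κ * ε * ‖(z i).2 - (z j).2‖ < 1 / 2)
    (hq : ε⁻¹ • (Torus.geometry (Fin 3)).sepVec (z i).1 (z j).1 ∈ strictTube κ ((z i).2 - (z j).2)) :
    firstContact ε (κ * ε) z (i, j) ∈ Ioc 0 (κ * ε) := by
  rw [firstContact_eq_mul_flightTime hε hchart hq]
  exact (isLeast_mul_flightTime hε hq).1.1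

/-- **The predicted separation of a strict-tube pair is `ε` times the impact normal**: at the first contact
time the free flights of `i`, `j` are at separation `ε n_h(ε⁻¹ q)`; in particular the line's predicted impact
datum `ε⁻¹ sepVec x̂ᵢ x̂ⱼ` is the tube's `impactNormal (vᵢ − vⱼ) (ε⁻¹ q)`. [folklore] -/
theorem sepVec_freeFlight_firstContact {ε κ : ℝ} (hε : 0 < ε) {z : Config n (Fin 3) T3} {i j : Fin n}
    (hchart : ‖(Torus.geometry (Fin 3)).sepVec (z i).1 (z j).1‖ + κ * ε * ‖(z i).2 - (z j).2‖ < 1 / 2)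
    (hq : ε⁻¹ • (Torus.geometry (Fin 3)).sepVec (z i).1 (z j).1 ∈ strictTube κ ((z i).2 - (z j).2)) :
    (Torus.geometry (Fin 3)).sepVec
        (freeFlight (Torus.geometry (Fin 3)) (firstContact ε (κ * ε) z (i, j)) z i).1
        (freeFlight (Torus.geometry (Fin 3)) (firstContact ε (κ * ε) z (i, j)) z j).1 =
      ε • impactNormal ((z i).2 - (z j).2) (ε⁻¹ • (Torus.geometry (Fin 3)).sepVec (z i).1 (z j).1) := by
  have hmem := firstContact_mem_Ioc hε hchart hq
  rw [sepVec_freeFlight_eq_of_chart hchart hmem.1.le hmem.2, firstContact_eq_mul_flightTime hε hchart hq,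
    add_mul_flightTime_smul hε]

/-- The rescaled predicted separation of a strict-tube pair IS the impact normal. [folklore] -/
theorem inv_smul_sepVec_freeFlight_firstContact {ε κ : ℝ} (hε : 0 < ε) {z : Config n (Fin 3) T3} {i j : Fin n}
    (hchart : ‖(Torus.geometry (Fin 3)).sepVec (z i).1 (z j).1‖ + κ * ε * ‖(z i).2 - (z j).2‖ < 1 / 2)
    (hq : ε⁻¹ • (Torus.geometry (Fin 3)).sepVec (z i).1 (z j).1 ∈ strictTube κ ((z i).2 - (z j).2)) :
    ε⁻¹ • (Torus.geometry (Fin 3)).sepVec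
        (freeFlight (Torus.geometry (Fin 3)) (firstContact ε (κ * ε) z (i, j)) z i).1
        (freeFlight (Torus.geometry (Fin 3)) (firstContact ε (κ * ε) z (i, j)) z j).1 =
      impactNormal ((z i).2 - (z j).2) (ε⁻¹ • (Torus.geometry (Fin 3)).sepVec (z i).1 (z j).1) := by
  rw [sepVec_freeFlight_firstContact hε hchart hq, smul_smul, inv_mul_cancel₀ hε.ne', one_smul]

/-- At the first contact time a strict-tube pair is exactly at distance `ε`. [folklore] -/
theorem norm_sepVec_freeFlight_firstContact {ε κ : ℝ} (hε : 0 < ε) {z : Config n (Fin 3) T3} {i j : Fin n}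
    (hchart : ‖(Torus.geometry (Fin 3)).sepVec (z i).1 (z j).1‖ + κ * ε * ‖(z i).2 - (z j).2‖ < 1 / 2)
    (hq : ε⁻¹ • (Torus.geometry (Fin 3)).sepVec (z i).1 (z j).1 ∈ strictTube κ ((z i).2 - (z j).2)) :
    ‖(Torus.geometry (Fin 3)).sepVec
        (freeFlight (Torus.geometry (Fin 3)) (firstContact ε (κ * ε) z (i, j)) z i).1
        (freeFlight (Torus.geometry (Fin 3)) (firstContact ε (κ * ε) z (i, j)) z j).1‖ = ε := by
  rw [sepVec_freeFlight_firstContact hε hchart hq, norm_smul, Real.norm_eq_abs, abs_of_pos hε,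
    (strictTube_spec hq).2.1, mul_one]

/-! ## The would-be marked sum dominates the strict-tube marked sum (nonnegative marks) -/

/-- **One-sided bridge for the floor.**  For a nonnegative mark `F` and a configuration all of whose strict-tube
pairs are inside the chart (e.g. `ε (1 + 2κ‖vᵢ − vⱼ‖) < 1/2` for the pairs that count, `chart_of_smul_mem_strictTube`),
the would-be marked sum of the window `(0, κε]` is at least the sum, over the ordered pairs `i ≠ j` whose rescaled
separation lies in the strict unit tube of their relative velocity, of the mark read at the tube's predicted datum
(first contact time `ε t_h`, free-flight positions there, window-start velocities). [folklore] -/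
theorem tubeSum_le_wouldBeSum {ε κ : ℝ} (hε : 0 < ε) (z : Config n (Fin 3) T3) (s : ℝ)
    {F : ℝ → T3 → T3 → V3 → V3 → ℝ} (hF : ∀ u x y v w, 0 ≤ F u x y v w)
    (hchart : ∀ i j : Fin n, i ≠ j →
      ε⁻¹ • (Torus.geometry (Fin 3)).sepVec (z i).1 (z j).1 ∈ strictTube κ ((z i).2 - (z j).2) →
      ‖(Torus.geometry (Fin 3)).sepVec (z i).1 (z j).1‖ + κ * ε * ‖(z i).2 - (z j).2‖ < 1 / 2) :
    ∑ i : Fin n, ∑ j : Fin n,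
        (if i ≠ j ∧ ε⁻¹ • (Torus.geometry (Fin 3)).sepVec (z i).1 (z j).1 ∈ strictTube κ ((z i).2 - (z j).2) then
          F (s + firstContact ε (κ * ε) z (i, j))
            (freeFlight (Torus.geometry (Fin 3)) (firstContact ε (κ * ε) z (i, j)) z i).1
            (freeFlight (Torus.geometry (Fin 3)) (firstContact ε (κ * ε) z (i, j)) z j).1 (z i).2 (z j).2
        else 0) ≤
      wouldBeSum ε (κ * ε) z s F := by
  rw [wouldBeSum, ← Finset.sum_product']
  -- the tube pairs form a subset of the would-be pairs; all terms are nonnegative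
  set T : Finset (Fin n × Fin n) := (Finset.univ ×ˢ Finset.univ).filter fun p =>
    p.1 ≠ p.2 ∧ ε⁻¹ • (Torus.geometry (Fin 3)).sepVec (z p.1).1 (z p.2).1 ∈ strictTube κ ((z p.1).2 - (z p.2).2)
    with hT
  have hsub : T ⊆ wouldBePairs ε (κ * ε) z := by
    intro p hp
    simp only [hT, Finset.mem_filter, Finset.mem_product, Finset.mem_univ, true_and] at hp
    exact mem_wouldBePairs_of_smul_mem_strictTube hε hp.1 (hchart p.1 p.2 hp.1 hp.2) hp.2
  rw [← Finset.sum_filter]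
  exact Finset.sum_le_sum_of_subset_of_nonneg hsub fun p _ _ => hF _ _ _ _ _

/-- **Registered helper stub `stub_tubeSumLeWouldBeSum`** of crux stmt-AtomisticToContinuum-13080 (line `Sketch`, input of `stub_staticOpacityFloorRung0`),
closed signature form of the file's main result. [folklore] -/
theorem stub_tubeSumLeWouldBeSum : ∀ (n : ℕ) (ε κ : ℝ), 0 < ε → ∀ (z : Config n (Fin 3) T3) (s : ℝ) (F : ℝ → T3 → T3 → V3 → V3 → ℝ), (∀ u x y v w, 0 ≤ F u x y v w) → (∀ i j : Fin n, i ≠ j → ε⁻¹ • (Torus.geometry (Fin 3)).sepVec (z i).1 (z j).1 ∈ strictTube κ ((z i).2 - (z j).2) → ‖(Torus.geometry (Fin 3)).sepVec (z i).1 (z j).1‖ + κ * ε * ‖(z i).2 - (z j).2‖ < 1 / 2) → (∑ i : Fin n, ∑ j : Fin n, (if i ≠ j ∧ ε⁻¹ • (Torus.geometry (Fin 3)).sepVec (z i).1 (z j).1 ∈ strictTube κ ((z i).2 - (z j).2) then F (s + RateFloorLine.firstContact ε (κ * ε) z (i, j)) (freeFlight (Torus.geometry (Fin 3)) (RateFloorLine.firstContact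 ε (κ * ε) z (i, j)) z i).1 (freeFlight (Torus.geometry (Fin 3)) (RateFloorLine.firstContact ε (κ * ε) z (i, j)) z j).1 (z i).2 (z j).2 else 0)) ≤ RateFloorLine.wouldBeSum ε (κ * ε) z s F :=
  fun _n _ε _κ hε z s _F hF hchart => tubeSum_le_wouldBeSum hε z s hF hchart

end RateFloorTubeBridge

end Summit.AtomisticToContinuum.HydrodynamicLimit.Theorems

end
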